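import Summits.CriticalPhenomena.PercolationContinuityZ3.Theorems.FK.InfiniteVolumeDefs
import HarnessLib

/-!
# FK-continuity transplant, FO-06 (interface half): the hypothesis structure `FKGibbs` — an
# infinite-volume random-cluster measure on `ℤ^d` in the free/wired SANDWICH form of the DLR property

Cell `fk-continuity` (bschramm), row FO-06 seat A (the wave-2 GATING file, registry row FO-06a-1); support file
for the FK-continuity transplant (`--supports stmt-CriticalPhenomena-4575`); builds on p205010 (kernel theorem,
internal audit signed; external expert review pending).  A hypothesis structure and its immediate unfoldings
only (no `sorry`, no named fact, no construction); vocabulary = the cell's `InfiniteVolumeDefs.lean` (seat B: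
`liftEdges`, `rcBoxLaw`, `IsBoxLimit`, `rcLimit`) and the tree's `rcMeasure` / `finsetGraph` / `wiredBoundary` /
`edgesIn`.

## What `FKGibbs d p q P` says (Grimmett 2006, Lemma (4.13) with Lemma (4.14)(b), read in infinite volume)

`P` is a probability measure on bond configurations of `ℤ^d`, carried by lattice configurations, such that for
every finite region `Λ ⊆ ℤ^d` (finite vertex set; `E_Λ` = the nearest-neighbour edges with both endpoints in `Λ`,
the tree's `edgesIn (zdGraph d) Λ`), every INCREASING event `A` determined by the edges of `E_Λ`, and every event
`H` determined by a finite set `T` of pairs disjoint from `E_Λ` ("local information outside `Λ`"):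

  `φ⁰_{Λ,p,q}(A) · P(H) ≤ P(A ∩ H) ≤ φ¹_{Λ,p,q}(A) · P(H)`,

where `φ⁰_{Λ,p,q}` is the free random-cluster measure of the finite graph `(Λ, E_Λ)` (`rcMeasure … ∅`) and
`φ¹_{Λ,p,q}` the one with the inner vertex boundary `∂Λ` wired (`rcMeasure … (wiredBoundary (zdGraph d) Λ)`),
both read on `ℤ^d` through `liftEdges Λ`.  In words: conditionally on any local information outside `Λ`, the law
of the configuration inside `Λ` lies stochastically between the free and the wired measure of `Λ`.  This is the
domain Markov property (Lemma (4.13): the conditional law given `𝒯_Λ` is a finite-volume measure `φ^ξ_{Λ,p,q}`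
with the boundary condition `ξ` induced from outside) COMBINED with the comparison of boundary conditions
(Lemma (4.14)(b): `φ⁰_Λ ≤st φ^ξ_Λ ≤st φ¹_Λ` for `q ≥ 1`) — the form in which exploration arguments of
Kozma–Nitzan type consume the Gibbs structure (cell SCOPING.md §3.6, crux C1: every probe bound is taken under
the worst-case boundary condition compatible with the history).

## Why the sandwich and not the DLR equation (4.30)

The DLR equation proper (Grimmett 2006, Def. (4.29)–(4.30): `P(A | 𝒯_Λ)(ξ) = φ^ξ_{Λ,p,q}(A)` a.s., with `ξ`
the INFINITE outside configuration) does hold for the limit measures `φ^b_{p,q}` (Thm. (4.34)(b)), but its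
printed proof goes through Thm. (4.31): almost-sure quasilocality (Lemma (4.39)) plus the 0/1-infinite-cluster
property, i.e. Burton–Keane uniqueness — which in this programme is row FO-08, itself built on FO-06.  The
sandwich, by contrast, passes to the limit `Λ_n ↑ ℤ^d` from the tree's finite-volume theorems
(`rcMeasure_real_inter_cylinder_le_mul_fromEdgeSet(_of_isLowerSet)`, `RandomClusterConditionalDomination.lean`;
transport `RandomClusterEmbedding.lean`) for BOTH limits `φ⁰_{p,q}`, `φ¹_{p,q}` — that discharge,
`IsBoxLimit.fkGibbs`, is the companion file `InfiniteVolumeDLR.lean` (row FO-06a-2) — and it is exactly what the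
consumers (FO-10 domain-Markov toolkit, FO-11 continuation principle) need.  Sharper lower bounds crediting the
wiring FORCED by the history (C1's `φ^{0, C(h) wired}_{F(h)}`) are FO-10 theorems over `IsBoxLimit` (finite-volume
side: `RandomClusterExploredWiring.lean`), not fields.  Finite energy (Thm. (3.1) eq. (3.3) / (4.17)(b)) is the
sandwich for the one-edge region; translation invariance, positive association and insertion/deletion tolerance
of `φ^b_{p,q}` are seat B's theorems about `IsBoxLimit` (`InfiniteVolume{Invariance,FKG,FiniteEnergy}.lean`);
ergodicity is `InfiniteVolumeErgodic.lean` (row FO-06a-3).  None of them is a field here (coordinator ruling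
2026-08-20T23:58Z: FO-08 types against the four fields of the tree's `IsInsertionTolerantErgodic` directly).

Posit-interface rule: a consumer taking `(hG : FKGibbs d p q P)` is conditional on `IsBoxLimit.fkGibbs` (and on
the existence theorem `isBoxLimit_rcLimit`, seat B) until those land, and says so.

## References

* G. Grimmett, *The Random-Cluster Model*, Springer 2006: §4.2 (4.11)–(4.13), Lemma (4.13), Lemma (4.14)(b); §4.3
  Thm. (4.17), Thm. (4.19), (4.21); §4.4 Def. (4.29)–(4.30), Thm. (4.31), Thm. (4.34), Lemma (4.39). [Grimmett2006]
-/

noncomputable section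

open MeasureTheory Set Filter
open scoped Topology ENNReal

namespace Summit.CriticalPhenomena.PercolationContinuityZ3.Theorems.FK

open Literature.Probability.Percolation Literature.Probability.LatticeModels

variable {d : ℕ}

/-! ### The free / wired laws of a finite region, read on `ℤ^d` -/

section RegionLaws

variable (d)

/-- `φ⁰_{Λ,p,q}(A)`: the FREE random-cluster measure of the finite region `(Λ, E_Λ)` of `ℤ^d` (no wired vertex)
of the pull-back of the `ℤ^d`-event `A` along `liftEdges Λ`. [cite: Grimmett2006, §4.2 (4.11)–(4.12), ξ = 0] -/
def regionFreeReal (p q : ℝ) (Λ : Finset (Site d)) (A : Set (BondConfig (Site d))) : ℝ :=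
  (rcMeasure (finsetGraph (zdGraph d) Λ) p q ∅).real (liftEdges Λ ⁻¹' A)

/-- `φ¹_{Λ,p,q}(A)`: the WIRED random-cluster measure of the finite region `(Λ, E_Λ)` of `ℤ^d` (inner vertex
boundary `∂Λ` wired into one cluster) of the pull-back of the `ℤ^d`-event `A` along `liftEdges Λ`.
[cite: Grimmett2006, §4.2 (4.11)–(4.12), ξ = 1] -/
def regionWiredReal (p q : ℝ) (Λ : Finset (Site d)) (A : Set (BondConfig (Site d))) : ℝ :=
  (rcMeasure (finsetGraph (zdGraph d) Λ) p q (wiredBoundary (zdGraph d) Λ)).real (liftEdges Λ ⁻¹' A)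

variable {d}

/-- On a box the free region law is the free box law of `InfiniteVolumeDefs` (`b = false`).
[cite: Grimmett2006, §4.2 (4.11)–(4.12)] -/
theorem regionFreeReal_box (p q : ℝ) (n : ℕ) {A : Set (BondConfig (Site d))} (hA : MeasurableSet A) :
    regionFreeReal d p q (box d n) A = (rcBoxLaw d false p q n).real A := by
  rw [regionFreeReal, rcBoxLaw, rcBoxMeasure_false, map_measureReal_apply (measurable_of_finite _) hA]

/-- On a box the wired region law is the wired box law of `InfiniteVolumeDefs` (`b = true`).
[cite: Grimmett2006, §4.2 (4.11)–(4.12)] -/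
theorem regionWiredReal_box (p q : ℝ) (n : ℕ) {A : Set (BondConfig (Site d))} (hA : MeasurableSet A) :
    regionWiredReal d p q (box d n) A = (rcBoxLaw d true p q n).real A := by
  rw [regionWiredReal, rcBoxLaw, rcBoxMeasure_true, map_measureReal_apply (measurable_of_finite _) hA]

/-- `0 ≤ φ⁰_{Λ,p,q}(A)`. [cite: Grimmett2006, §4.2] -/
theorem regionFreeReal_nonneg (p q : ℝ) (Λ : Finset (Site d)) (A : Set (BondConfig (Site d))) :
    0 ≤ regionFreeReal d p q Λ A := measureReal_nonneg

/-- `φ¹_{Λ,p,q}(A) ≤ 1` for `0 ≤ p ≤ 1`, `0 < q`. [cite: Grimmett2006, §4.2 (4.12)] -/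
theorem regionWiredReal_le_one {p q : ℝ} (hp : p ∈ Set.Icc (0 : ℝ) 1) (hq : 0 < q) (Λ : Finset (Site d))
    (A : Set (BondConfig (Site d))) : regionWiredReal d p q Λ A ≤ 1 := by
  haveI := isProbabilityMeasure_rcMeasure (finsetGraph (zdGraph d) Λ) hp hq (wiredBoundary (zdGraph d) Λ)
  exact measureReal_le_one

end RegionLaws

/-! ### The interface -/

/-- **`FKGibbs d p q P`: an infinite-volume random-cluster measure on `ℤ^d` with parameters `p, q`, in the
free/wired sandwich form of the DLR property** (hypothesis structure).  `P` is a probability measure on bond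
configurations of `ℤ^d`, carried by lattice configurations, and for every finite region `Λ`, every increasing event
`A` determined by `E_Λ = edgesIn (zdGraph d) Λ`, and every event `H` determined by a finite set `T` of pairs
disjoint from `E_Λ`: `φ⁰_{Λ,p,q}(A) · P(H) ≤ P(A ∩ H) ≤ φ¹_{Λ,p,q}(A) · P(H)` (Grimmett 2006, Lemma (4.13):
the conditional law on `E_Λ` given `𝒯_Λ` is a finite-volume random-cluster measure with induced boundary
condition; Lemma (4.14)(b): every such measure lies stochastically between the free and the wired one, `q ≥ 1`).
Satisfied by both limit measures `φ⁰_{p,q}`, `φ¹_{p,q}` for `p ∈ [0,1]`, `q ≥ 1` (companion file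
`InfiniteVolumeDLR.lean`, theorem `IsBoxLimit.fkGibbs`); the DLR equation (4.30) itself is not a field (see the
module docstring). [cite: Grimmett2006, Lemma (4.13) and Lemma (4.14)(b); Thm. (4.19)(c) (4.21)] -/
structure FKGibbs (d : ℕ) (p q : ℝ) (P : Measure (BondConfig (Site d))) : Prop where
  /-- `P` is a probability measure. -/
  isProbabilityMeasure : IsProbabilityMeasure P
  /-- `P`-a.s. only nearest-neighbour bonds of `ℤ^d` are open. -/
  ae_subset_edgeSet : ∀ᵐ ω ∂P, ω ⊆ (zdGraph d).edgeSet
  /-- Lower sandwich: given local information `H` outside `E_Λ`, an increasing `E_Λ`-event is at least as likely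
  as under the FREE measure of `Λ`. -/
  free_mul_le : ∀ (Λ : Finset (Site d)) ⦃A H : Set (BondConfig (Site d))⦄ (T : Finset (Sym2 (Site d))),
    IsUpperSet A → DeterminedBy A ↑(edgesIn (zdGraph d) Λ) →
    Disjoint (↑T : Set (Sym2 (Site d))) ↑(edgesIn (zdGraph d) Λ) → DeterminedBy H ↑T →
    regionFreeReal d p q Λ A * P.real H ≤ P.real (A ∩ H)
  /-- Upper sandwich: … and at most as likely as under the WIRED measure of `Λ` (`∂Λ` wired). -/
  le_wired_mul : ∀ (Λ : Finset (Site d)) ⦃A H : Set (BondConfig (Site d))⦄ (T : Finset (Sym2 (Site d))),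
    IsUpperSet A → DeterminedBy A ↑(edgesIn (zdGraph d) Λ) →
    Disjoint (↑T : Set (Sym2 (Site d))) ↑(edgesIn (zdGraph d) Λ) → DeterminedBy H ↑T →
    P.real (A ∩ H) ≤ regionWiredReal d p q Λ A * P.real H

namespace FKGibbs

variable {p q : ℝ} {P : Measure (BondConfig (Site d))}

/-- Unconditioned lower bound (`H = univ`): an increasing `E_Λ`-event is at least as likely under `P` as under the
free measure of `Λ` (Grimmett 2006, (4.21) with `b = 0` / (4.24)). [cite: Grimmett2006, Thm. (4.19)(c) (4.21)] -/
theorem regionFreeReal_le (hP : FKGibbs d p q P) (Λ : Finset (Site d)) {A : Set (BondConfig (Site d))}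
    (hA : IsUpperSet A) (hAΛ : DeterminedBy A ↑(edgesIn (zdGraph d) Λ)) : regionFreeReal d p q Λ A ≤ P.real A := by
  haveI := hP.isProbabilityMeasure
  have h := hP.free_mul_le Λ (H := Set.univ) ∅ hA hAΛ (by simp) ((determinedBy_iff _ _).2 fun _ _ _ => Iff.rfl)
  simpa using h

/-- Unconditioned upper bound (`H = univ`): an increasing `E_Λ`-event is at most as likely under `P` as under the
wired measure of `Λ` (Grimmett 2006, (4.21) with `b = 1`). [cite: Grimmett2006, Thm. (4.19)(c) (4.21)] -/
theorem le_regionWiredReal (hP : FKGibbs d p q P) (Λ : Finset (Site d)) {A : Set (BondConfig (Site d))}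
    (hA : IsUpperSet A) (hAΛ : DeterminedBy A ↑(edgesIn (zdGraph d) Λ)) : P.real A ≤ regionWiredReal d p q Λ A := by
  haveI := hP.isProbabilityMeasure
  have h := hP.le_wired_mul Λ (H := Set.univ) ∅ hA hAΛ (by simp) ((determinedBy_iff _ _).2 fun _ _ _ => Iff.rfl)
  simpa using h

/-- Conditional form of the lower sandwich: `φ⁰_{Λ,p,q}(A) ≤ P(A | H) = P(A ∩ H) / P(H)` for `P(H) > 0`.
[cite: Grimmett2006, Lemma (4.13) and Lemma (4.14)(b)] -/
theorem regionFreeReal_le_cond (hP : FKGibbs d p q P) (Λ : Finset (Site d)) {A H : Set (BondConfig (Site d))}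
    (T : Finset (Sym2 (Site d))) (hA : IsUpperSet A) (hAΛ : DeterminedBy A ↑(edgesIn (zdGraph d) Λ))
    (hT : Disjoint (↑T : Set (Sym2 (Site d))) ↑(edgesIn (zdGraph d) Λ)) (hH : DeterminedBy H ↑T)
    (hH0 : 0 < P.real H) : regionFreeReal d p q Λ A ≤ P.real (A ∩ H) / P.real H := by
  rw [le_div_iff₀ hH0]
  exact hP.free_mul_le Λ T hA hAΛ hT hH

/-- Conditional form of the upper sandwich: `P(A | H) = P(A ∩ H) / P(H) ≤ φ¹_{Λ,p,q}(A)` for `P(H) > 0`.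
[cite: Grimmett2006, Lemma (4.13) and Lemma (4.14)(b)] -/
theorem cond_le_regionWiredReal (hP : FKGibbs d p q P) (Λ : Finset (Site d)) {A H : Set (BondConfig (Site d))}
    (T : Finset (Sym2 (Site d))) (hA : IsUpperSet A) (hAΛ : DeterminedBy A ↑(edgesIn (zdGraph d) Λ))
    (hT : Disjoint (↑T : Set (Sym2 (Site d))) ↑(edgesIn (zdGraph d) Λ)) (hH : DeterminedBy H ↑T)
    (hH0 : 0 < P.real H) : P.real (A ∩ H) / P.real H ≤ regionWiredReal d p q Λ A := by
  rw [div_le_iff₀ hH0]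
  exact hP.le_wired_mul Λ T hA hAΛ hT hH

/-- Decreasing events: the sandwich REVERSES — given local information outside, a decreasing `E_Λ`-event is at
most as likely as under the FREE measure of `Λ` (complement of the lower sandwich). [cite: Grimmett2006, Lemma (4.14)(b)] -/
theorem le_free_mul_of_isLowerSet (hP : FKGibbs d p q P) (hp : p ∈ Set.Icc (0 : ℝ) 1) (hq : 0 < q)
    (Λ : Finset (Site d)) {D H : Set (BondConfig (Site d))} (T : Finset (Sym2 (Site d))) (hD : IsLowerSet D)
    (hDΛ : DeterminedBy D ↑(edgesIn (zdGraph d) Λ)) (hDm : MeasurableSet D)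
    (hT : Disjoint (↑T : Set (Sym2 (Site d))) ↑(edgesIn (zdGraph d) Λ)) (hH : DeterminedBy H ↑T) :
    P.real (D ∩ H) ≤ regionFreeReal d p q Λ D * P.real H := by
  haveI := hP.isProbabilityMeasure
  haveI := isProbabilityMeasure_rcMeasure (finsetGraph (zdGraph d) Λ) hp hq (∅ : Set ↥Λ)
  -- the complement `Dᶜ` is increasing and determined by `E_Λ`
  have hDc : IsUpperSet Dᶜ := hD.compl
  have hDcΛ : DeterminedBy Dᶜ ↑(edgesIn (zdGraph d) Λ) := by
    rw [determinedBy_iff] at hDΛ ⊢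
    exact fun ω ω' h => not_congr (hDΛ ω ω' h)
  have h := hP.free_mul_le Λ T hDc hDcΛ hT hH
  -- `P(Dᶜ ∩ H) = P(H) - P(D ∩ H)` and `φ⁰(Dᶜ) = 1 - φ⁰(D)`
  have h1 : P.real (Dᶜ ∩ H) = P.real H - P.real (D ∩ H) := by
    have h0 : P.real (H ∩ D) + P.real (H \ D) = P.real H := measureReal_inter_add_sdiff (s := H) hDm
    rw [Set.sdiff_eq_compl_inter, Set.inter_comm H D] at h0
    linarith
  have h2 : regionFreeReal d p q Λ Dᶜ = 1 - regionFreeReal d p q Λ D := by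
    rw [regionFreeReal, regionFreeReal, Set.preimage_compl, measureReal_compl]
    · simp
    · exact measurableSet_preimage (measurable_of_finite _) hDm
  rw [h1, h2] at h
  nlinarith [h, measureReal_nonneg (μ := P) (s := H)]

end FKGibbs

end Summit.CriticalPhenomena.PercolationContinuityZ3.Theorems.FK

end
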